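import Summits.ABC.IUTFork.Repair.RHInnerConductorTie
import Summits.ABC.IUTFork.Cor312ProvKIdeles
import Literature.IUT.LogVolume.RescaledCompletionInvariants
import Literature.IUT.LogVolume.GenuineThetaFieldCyclotomicRamification
import HarnessLib

/-!
# D-0079 RESCUE sub-cell R-H (rows 15 / 20 / 27): the tie-place inner conductor AT THE PILOT-DATUM BED `K_x = kOf X p x`,
# and at the GENUINE Θ-volume datum over `p ∈ {3, 5}` (`ζ_p ∈ F` by the rational `30`-torsion): 15R CERTIFIED whenever `p ∤ e_x/(p−1)`

PROOF-ONLY sequel (0 definitions, 0 `Prop` facts; seat abc-iut-rh-typ-12 gen 4, row-15 hand) of `Repair.RHInnerConductorTie` (p480437), which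
decided the inner conductor `c` of `log_p(𝒪_K^×)` at a tie `e = A·(p−1)` over ONE local field from the torsion exponent `m = torsionPExp p K`
and one congruence. This file instantiates it at the completions `K_x = kOf X p x` of a Dupuy–Hilado pilot datum `X : PilotData L`
(`Cor312Prov.pilotDataOfK D K` included) and discharges the input «`ζ_p ∈ K_x`» STRUCTURALLY at the genuine Θ-volume datum:

* §1 `exists_pow_eq_one_ne_one_kOf` — a root of unity `ζ ≠ 1` of the NUMBER FIELD `L` stays one in every completion `K_x` (`L → L_v ≃ K_x`
  is an injective ring map); hence (`sub_one_dvd_and_one_le_torsionPExp_kOf`) at every `x ∣ p` with `ζ_p ∈ L`: `(p−1) ∣ e_x` and `m_x ≥ 1`.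
* §2 **`isInnerConductor_kOf_rInUb_of_root`**: `ζ_p ∈ L`, `p` odd, `p ∤ e_x/(p−1)` ⇒ `c_x = e_x/(p−1) + 1 = r_in_ub(x)` EXACTLY, and
  **`exists_inner_certificate_rInUb_kOf_of_root`**: the 15R certificate «`∃ u ∉ log_p(𝒪_x^×), ‖u‖ ≤ ‖ϖ_x‖^{⌊e_x/(p−1)⌋}`» HOLDS at `x`
  (`RH.InnerConductorTie.isInnerConductor_tie_succ_of_not_pow_torsionPExp_dvd`: `p ∤ A ⇒ p^{m} ∤ A`).
* §3 AT THE GENUINE Θ-VOLUME DATUM `T : Cor22.ThetaVolumeDatumAt P l` (`X := pilotDataOfK T.D T.K`): `ζ_p ∈ F ⊆ K` for `p ∣ 30`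
  (`Cor22.ThetaVolumeDatumAt.exists_isPrimitiveRoot_F`, [IUTchIV] Thm. 1.10 «the 3·5-torsion of `E_F` is `F`-rational» + Weil pairing), so
  **`ThetaVolumeDatumAt.isInnerConductor_kOf_rInUb_of_dvd_thirty`**: at EVERY place `x ∣ p`, `p ∈ {3, 5}`, with `p ∤ e_x/(p−1)` the inner
  conductor is `r_in_ub(x)` and 15R is certified — NO numerics. On rh2-tab-1's 86 «15R at (p−1) ∣ e_w UNCERTIFIED» rows (MASS-T-FQD-v1-places
  120c64d0431057f3) this is the 25 genuine frey rows at `(p, e_v) ∈ {(3, 2), (3, 10), (5, 4)}` (`3 ∤ e_w/2`, `5 ∤ e_w/4`); the 32 genuine rows at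
  `(3, 30), (5, 20), (5, 60)` are DEEP (`p ∣ e_x/(p−1)`): there `m_x ≥ 1` is now pinned and the ONE remaining bit is the generator congruence of
  `RH.InnerConductorTie.exists_inner_certificate_rInUb_iff_generator` (kit); the 29 rows at `p ∈ {7, 11}` (23 hex-v2 / lamSeven / HEX-strip /
  not-genuine-type at `p = 7`; 6 at `p = 11`, of which 3 genuine-pinned + 2 candidates) need the bit `m_x ≥ 1` («`ζ_p ∈ K_x`?», kit).

HONEST FRAMING: classical local algebra + the tree's typed genuine datum; every R-H candidate remains a HYPOTHESIS; nothing here asserts abc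
proved or refuted; no side is taken on [IUTchIII] Cor. 3.12 or on any author; typed ≠ proved; certified ≠ endorsed.
-/

noncomputable section

open Set Metric NumberField IsDedekindDomain

namespace Summit.ABC.IUTFork.Repair.RH.InnerConductorTie

open Literature.IUT.LogVolume Literature.IUT.LogVolume.LogEnvelope Literature.NumberTheory.GaloisRepresentations.Ultrametric
  Literature.NumberTheory.NumberFields Summit.ABC.IUTFork.Repair.RH.LinearReachLaw
  Summit.ABC.IUTFork.Thm311 Summit.ABC.IUTFork.Thm311.Real Summit.ABC.IUTFork.Cor312 Summit.ABC.IUTFork.Cor312Prov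

/-! ## §1. Roots of unity of the number field persist in every completion `K_x` -/

section Bed

variable {L : Type} [Field L] [NumberField L] (X : PilotData L)

/-- **A root of unity `ζ ≠ 1` of `L` gives one in `K_x = kOf X p x`** (the composite `L → L_v → K_x` of the completion map and abc-iut-S7's
rescaling identity is an injective ring homomorphism). [cite: NeukirchANT1999, Ch. II Thm. (4.8)] -/
theorem exists_pow_eq_one_ne_one_kOf (pp : Nat.Primes) [Fact (pp : ℕ).Prime] (x : (thetaIndex X).Fibre (.inr pp)) {n : ℕ} {ζ : L}
    (hζ : ζ ^ n = 1) (hζ1 : ζ ≠ 1) : ∃ ζ' : kOf X pp.1 x, ζ' ^ n = 1 ∧ ζ' ≠ 1 := by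
  let φ : L →+* kOf X pp.1 x :=
    (RescaledCompletion.of L pp.1 (placeOf X pp.1 x) (natCast_mem_placeOf X pp.1 x)).toRingHom.comp
      (algebraMap L ((placeOf X pp.1 x).adicCompletion L))
  refine ⟨φ ζ, by rw [← map_pow, hζ, map_one], fun h => hζ1 (φ.injective ?_)⟩
  rw [h, map_one]

/-- **`ζ_p ∈ L` ⇒ at every `x ∣ p`: `(p−1) ∣ e_x` and `m_x = torsionPExp p K_x ≥ 1`** (`torsionPExp_eq_zero_of_not_pred_dvd`,
`forall_pow_prime_eq_one_of_torsionPExp_eq_zero`, `e(K_x) = e_x` by `absRamificationIdx_rescaledCompletion`).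
[cite: NeukirchANT1999, Ch. II Prop. (5.7), (7.13)] -/
theorem sub_one_dvd_and_one_le_torsionPExp_kOf (pp : Nat.Primes) [Fact (pp : ℕ).Prime] (x : (thetaIndex X).Fibre (.inr pp)) {ζ : L}
    (hζ : ζ ^ (pp : ℕ) = 1) (hζ1 : ζ ≠ 1) :
    ((pp : ℕ) - 1 ∣ (placeOf X pp.1 x).asIdeal.ramificationIdx ℤ) ∧ 1 ≤ torsionPExp pp (kOf X pp.1 x) := by
  have he : absRamificationIdx pp (kOf X pp.1 x) = (placeOf X pp.1 x).asIdeal.ramificationIdx ℤ :=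
    absRamificationIdx_rescaledCompletion L pp.1 (placeOf X pp.1 x) (natCast_mem_placeOf X pp.1 x)
  obtain ⟨ζ', hζ', hζ'1⟩ := exists_pow_eq_one_ne_one_kOf X pp x hζ hζ1
  have hm : 1 ≤ torsionPExp pp (kOf X pp.1 x) := by
    by_contra hm
    exact hζ'1 (forall_pow_prime_eq_one_of_torsionPExp_eq_zero pp (kOf X pp.1 x) (by omega) ζ' hζ')
  refine ⟨?_, hm⟩
  rw [← he]
  by_contra hnd
  have := torsionPExp_eq_zero_of_not_pred_dvd pp (kOf X pp.1 x) hnd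
  omega

/-! ## §2. `ζ_p ∈ L`, `p` odd, `p ∤ e_x/(p−1)`: the inner conductor of `K_x` is `r_in_ub(x)`; 15R certified at `x` -/

/-- **`ζ_p ∈ L`, `p` odd, `p ∤ e_x/(p−1)` ⇒ `c_x = e_x/(p−1) + 1 = r_in_ub(x)`** for every norm uniformizer `ϖ` of `K_x`
(`isInnerConductor_tie_succ_of_not_pow_torsionPExp_dvd` at `K_x`: `m_x ≥ 1` by §1, and `p ∤ A ⇒ p^{m_x} ∤ A`).
[cite: SerreLocalFields1979, Ch. XIV §4] [cite: NeukirchANT1999, Ch. II Prop. (5.5)–(5.7)] -/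
theorem isInnerConductor_kOf_rInUb_of_root (pp : Nat.Primes) [Fact (pp : ℕ).Prime] (hp2 : (pp : ℕ) ≠ 2)
    (x : (thetaIndex X).Fibre (.inr pp)) {ζ : L} (hζ : ζ ^ (pp : ℕ) = 1) (hζ1 : ζ ≠ 1) {ϖ : (kOf X pp.1 x)ˣ} (hϖ : IsUniformizer ϖ)
    (hndA : ¬ (pp : ℕ) ∣ (placeOf X pp.1 x).asIdeal.ramificationIdx ℤ / ((pp : ℕ) - 1)) :
    IsInnerConductor (kOf X pp.1 x) ϖ ((placeOf X pp.1 x).asIdeal.ramificationIdx ℤ / ((pp : ℕ) - 1) + 1) := by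
  have he : absRamificationIdx pp (kOf X pp.1 x) = (placeOf X pp.1 x).asIdeal.ramificationIdx ℤ :=
    absRamificationIdx_rescaledCompletion L pp.1 (placeOf X pp.1 x) (natCast_mem_placeOf X pp.1 x)
  obtain ⟨hdvd, hm⟩ := sub_one_dvd_and_one_le_torsionPExp_kOf X pp x hζ hζ1
  rw [← he] at hdvd hndA ⊢
  have hA : absRamificationIdx pp (kOf X pp.1 x) = absRamificationIdx pp (kOf X pp.1 x) / ((pp : ℕ) - 1) * ((pp : ℕ) - 1) :=
    (Nat.div_mul_cancel hdvd).symm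
  refine isInnerConductor_tie_succ_of_not_pow_torsionPExp_dvd (pp : ℕ) hϖ hA hp2 hm fun h => hndA ?_
  exact (dvd_pow_self (pp : ℕ) (by omega)).trans h

/-- **15R CERTIFIED at such a place**: `∃ u ∉ log_p(𝒪_x^×)` with `‖u‖ ≤ ‖ϖ_x‖^{⌊e_x/(p−1)⌋}` — the k2 door's `hsharp` binder at the round-1
donor `n₀(x) = r_in_ub(x) = ⌊e_x/(p−1)⌋ + 1`, for `ζ_p ∈ L`, `p` odd, `p ∤ e_x/(p−1)`. [cite: NeukirchANT1999, Ch. II Prop. (5.5)–(5.7)] -/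
theorem exists_inner_certificate_rInUb_kOf_of_root (pp : Nat.Primes) [Fact (pp : ℕ).Prime] (hp2 : (pp : ℕ) ≠ 2)
    (x : (thetaIndex X).Fibre (.inr pp)) {ζ : L} (hζ : ζ ^ (pp : ℕ) = 1) (hζ1 : ζ ≠ 1) {ϖ : (kOf X pp.1 x)ˣ} (hϖ : IsUniformizer ϖ)
    (hndA : ¬ (pp : ℕ) ∣ (placeOf X pp.1 x).asIdeal.ramificationIdx ℤ / ((pp : ℕ) - 1)) :
    ∃ u : kOf X pp.1 x, ‖u‖ ≤ ‖(ϖ : kOf X pp.1 x)‖ ^ ((((placeOf X pp.1 x).asIdeal.ramificationIdx ℤ / ((pp : ℕ) - 1) + 1 : ℕ) : ℤ) - 1) ∧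
      u ∉ logUnits (kOf X pp.1 x) := by
  rw [exists_inner_certificate_iff_le hϖ.1.le (isInnerConductor_kOf_rInUb_of_root X pp hp2 x hζ hζ1 hϖ hndA) (Nat.le_add_left 1 _)]

/-- **At a DEEP place (`p ∣ e_x/(p−1)`) with `ζ_p ∈ L` the bracket and the remaining bit**: `m_x ≥ 1`, `e_x = A·(p−1)`, the conductor is `A` or
`A + 1` (`isInnerConductor_tie_cases`), and it is `A + 1` (15R certified) iff the generator congruence of `exists_inner_certificate_rInUb_iff_generator`
is insoluble in `K_x` — restated at the bed so the kit seat's one computation per place closes the row. [cite: SerreLocalFields1979, Ch. XIV §4] -/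
theorem isInnerConductor_kOf_tie_cases_of_root (pp : Nat.Primes) [Fact (pp : ℕ).Prime] (hp2 : (pp : ℕ) ≠ 2)
    (x : (thetaIndex X).Fibre (.inr pp)) {ζ : L} (hζ : ζ ^ (pp : ℕ) = 1) (hζ1 : ζ ≠ 1) {ϖ : (kOf X pp.1 x)ˣ} (hϖ : IsUniformizer ϖ) :
    1 ≤ torsionPExp pp (kOf X pp.1 x) ∧
      absRamificationIdx pp (kOf X pp.1 x) = (placeOf X pp.1 x).asIdeal.ramificationIdx ℤ / ((pp : ℕ) - 1) * ((pp : ℕ) - 1) ∧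
      (IsInnerConductor (kOf X pp.1 x) ϖ ((placeOf X pp.1 x).asIdeal.ramificationIdx ℤ / ((pp : ℕ) - 1)) ∨
        IsInnerConductor (kOf X pp.1 x) ϖ ((placeOf X pp.1 x).asIdeal.ramificationIdx ℤ / ((pp : ℕ) - 1) + 1)) := by
  have he : absRamificationIdx pp (kOf X pp.1 x) = (placeOf X pp.1 x).asIdeal.ramificationIdx ℤ :=
    absRamificationIdx_rescaledCompletion L pp.1 (placeOf X pp.1 x) (natCast_mem_placeOf X pp.1 x)
  obtain ⟨hdvd, hm⟩ := sub_one_dvd_and_one_le_torsionPExp_kOf X pp x hζ hζ1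
  rw [← he] at hdvd ⊢
  have hA : absRamificationIdx pp (kOf X pp.1 x) = absRamificationIdx pp (kOf X pp.1 x) / ((pp : ℕ) - 1) * ((pp : ℕ) - 1) :=
    (Nat.div_mul_cancel hdvd).symm
  exact ⟨hm, hA, isInnerConductor_tie_cases (pp : ℕ) hϖ hA hp2⟩

end Bed

/-! ## §3. At the genuine Θ-volume datum: `ζ_p ∈ F ⊆ K` for `p ∣ 30`, so over `p ∈ {3, 5}` the conductor is `r_in_ub` off the deep places -/

section Genuine

open Literature.IUT.LogVolume.Cor22 Literature.NumberTheory.DiophantineGeometry.GenEll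

variable {P : NFPoint} {l : ℕ} (T : ThetaVolumeDatumAt P l)

/-- **`ζ_p ∈ K` at a genuine Θ-volume datum, for every prime `p ∣ 30`**: `ζ_p ∈ F` (`ThetaVolumeDatumAt.exists_isPrimitiveRoot_F`: the
`30`-torsion of `E_F` is `F`-rational, [IUTchIV] Thm. 1.10 p. 22, and the Weil pairing) pushed along `F → K = F(E_F[l])`.
[cite: Mochizuki2012, IUTchIV Thm. 1.10 p. 22] [cite: SilvermanAEC2009, Cor. III.8.1.1] [claim: Mochizuki2012, status: disputed] -/
theorem ThetaVolumeDatumAt.exists_pow_prime_eq_one_ne_one_K {p : ℕ} (hp : p.Prime) (hp30 : p ∣ 30) :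
    letI := T.instFieldF; letI := T.instFieldK; letI := T.instAlgebraK
    ∃ ζ : T.K, ζ ^ p = 1 ∧ ζ ≠ 1 := by
  letI := T.instFieldF; letI := T.instNumberFieldF; letI := T.instFieldK; letI := T.instAlgebraK; letI := T.instIsElliptic
  obtain ⟨ζ, hζ⟩ := T.exists_isPrimitiveRoot_F hp hp30
  refine ⟨algebraMap T.F T.K ζ, by rw [← map_pow, hζ.pow_eq_one, map_one], fun h => hζ.ne_one hp.one_lt ?_⟩
  exact (algebraMap T.F T.K).injective (by rw [h, map_one])

/-- **THE GENUINE ROWS DECIDED WITHOUT NUMERICS.** At a genuine Θ-volume datum `T` (`X := pilotDataOfK T.D T.K`), at EVERY place `x ∣ p` with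
`p ∈ {3, 5}` (`p ∣ 30`, `p ≠ 2`): `(p−1) ∣ e_x`, `m_x ≥ 1`, and if `p ∤ e_x/(p−1)` then for every norm uniformizer `ϖ` of `K_x` the inner
conductor is `e_x/(p−1) + 1 = r_in_ub(x)` and the 15R certificate holds at `x`. (Frey bed: `(p, e_v) ∈ {(3,2), (3,10), (5,4)}` rows.)
[cite: Mochizuki2012, IUTchIV Thm. 1.10 p. 22] [cite: NeukirchANT1999, Ch. II Prop. (5.5)–(5.7)] [claim: Mochizuki2012, status: disputed] -/
theorem ThetaVolumeDatumAt.isInnerConductor_kOf_rInUb_of_dvd_thirty (pp : Nat.Primes) (hp30 : (pp : ℕ) ∣ 30) (hp2 : (pp : ℕ) ≠ 2) :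
    letI := T.instFieldF; letI := T.instNumberFieldF; letI := T.instAlgebraF; letI := T.instFieldK; letI := T.instNumberFieldK;
    letI := T.instAlgebraK; letI := T.instFieldFbar; letI := T.instAlgebraFbar; letI := T.instAlgebraKFbar; letI := T.instIsElliptic
    haveI : Fact (pp : ℕ).Prime := ⟨pp.2⟩
    ∀ (x : (thetaIndex (pilotDataOfK T.D T.K)).Fibre (.inr pp)),
      ((pp : ℕ) - 1 ∣ (placeOf (pilotDataOfK T.D T.K) pp.1 x).asIdeal.ramificationIdx ℤ) ∧
      1 ≤ torsionPExp pp (kOf (pilotDataOfK T.D T.K) pp.1 x) ∧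
      (¬ (pp : ℕ) ∣ (placeOf (pilotDataOfK T.D T.K) pp.1 x).asIdeal.ramificationIdx ℤ / ((pp : ℕ) - 1) →
        ∀ (ϖ : (kOf (pilotDataOfK T.D T.K) pp.1 x)ˣ), IsUniformizer ϖ →
          IsInnerConductor (kOf (pilotDataOfK T.D T.K) pp.1 x) ϖ
              ((placeOf (pilotDataOfK T.D T.K) pp.1 x).asIdeal.ramificationIdx ℤ / ((pp : ℕ) - 1) + 1) ∧
            ∃ u : kOf (pilotDataOfK T.D T.K) pp.1 x,
              ‖u‖ ≤ ‖(ϖ : kOf (pilotDataOfK T.D T.K) pp.1 x)‖ ^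
                  ((((placeOf (pilotDataOfK T.D T.K) pp.1 x).asIdeal.ramificationIdx ℤ / ((pp : ℕ) - 1) + 1 : ℕ) : ℤ) - 1) ∧
                u ∉ logUnits (kOf (pilotDataOfK T.D T.K) pp.1 x)) := by
  letI := T.instFieldF; letI := T.instNumberFieldF; letI := T.instAlgebraF; letI := T.instFieldK; letI := T.instNumberFieldK
  letI := T.instAlgebraK; letI := T.instFieldFbar; letI := T.instAlgebraFbar; letI := T.instAlgebraKFbar; letI := T.instIsElliptic
  haveI : Fact (pp : ℕ).Prime := ⟨pp.2⟩
  intro x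
  obtain ⟨ζ, hζ, hζ1⟩ := ThetaVolumeDatumAt.exists_pow_prime_eq_one_ne_one_K T pp.2 hp30
  obtain ⟨hdvd, hm⟩ := sub_one_dvd_and_one_le_torsionPExp_kOf (pilotDataOfK T.D T.K) pp x hζ hζ1
  refine ⟨hdvd, hm, fun hndA ϖ hϖ => ⟨isInnerConductor_kOf_rInUb_of_root (pilotDataOfK T.D T.K) pp hp2 x hζ hζ1 hϖ hndA, ?_⟩⟩
  exact exists_inner_certificate_rInUb_kOf_of_root (pilotDataOfK T.D T.K) pp hp2 x hζ hζ1 hϖ hndA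

/-- **… and at the DEEP genuine places (`p ∣ e_x/(p−1)`, `p ∈ {3, 5}`) the conductor is `e_x/(p−1)` or `e_x/(p−1) + 1`, with `m_x ≥ 1`** — the one
remaining bit per place being the generator congruence (`RH.InnerConductorTie.exists_inner_certificate_rInUb_iff_generator` at `K_x`).
(Frey bed: the `(p, e_v) ∈ {(3,30), (5,20), (5,60)}` rows.) [cite: SerreLocalFields1979, Ch. XIV §4] [claim: Mochizuki2012, status: disputed] -/
theorem ThetaVolumeDatumAt.isInnerConductor_kOf_tie_cases_of_dvd_thirty (pp : Nat.Primes) (hp30 : (pp : ℕ) ∣ 30) (hp2 : (pp : ℕ) ≠ 2) :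
    letI := T.instFieldF; letI := T.instNumberFieldF; letI := T.instAlgebraF; letI := T.instFieldK; letI := T.instNumberFieldK;
    letI := T.instAlgebraK; letI := T.instFieldFbar; letI := T.instAlgebraFbar; letI := T.instAlgebraKFbar; letI := T.instIsElliptic
    haveI : Fact (pp : ℕ).Prime := ⟨pp.2⟩
    ∀ (x : (thetaIndex (pilotDataOfK T.D T.K)).Fibre (.inr pp)) (ϖ : (kOf (pilotDataOfK T.D T.K) pp.1 x)ˣ), IsUniformizer ϖ →
      1 ≤ torsionPExp pp (kOf (pilotDataOfK T.D T.K) pp.1 x) ∧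
        absRamificationIdx pp (kOf (pilotDataOfK T.D T.K) pp.1 x) =
          (placeOf (pilotDataOfK T.D T.K) pp.1 x).asIdeal.ramificationIdx ℤ / ((pp : ℕ) - 1) * ((pp : ℕ) - 1) ∧
        (IsInnerConductor (kOf (pilotDataOfK T.D T.K) pp.1 x) ϖ
            ((placeOf (pilotDataOfK T.D T.K) pp.1 x).asIdeal.ramificationIdx ℤ / ((pp : ℕ) - 1)) ∨
          IsInnerConductor (kOf (pilotDataOfK T.D T.K) pp.1 x) ϖ
            ((placeOf (pilotDataOfK T.D T.K) pp.1 x).asIdeal.ramificationIdx ℤ / ((pp : ℕ) - 1) + 1)) := by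
  letI := T.instFieldF; letI := T.instNumberFieldF; letI := T.instAlgebraF; letI := T.instFieldK; letI := T.instNumberFieldK
  letI := T.instAlgebraK; letI := T.instFieldFbar; letI := T.instAlgebraFbar; letI := T.instAlgebraKFbar; letI := T.instIsElliptic
  haveI : Fact (pp : ℕ).Prime := ⟨pp.2⟩
  intro x ϖ hϖ
  obtain ⟨ζ, hζ, hζ1⟩ := ThetaVolumeDatumAt.exists_pow_prime_eq_one_ne_one_K T pp.2 hp30
  exact isInnerConductor_kOf_tie_cases_of_root (pilotDataOfK T.D T.K) pp hp2 x hζ hζ1 hϖ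

end Genuine

end Summit.ABC.IUTFork.Repair.RH.InnerConductorTie

end
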